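import Summits.NavierStokesRegularity.NavierStokesRegularity.Theorems.ExtremiserTransienceTwoThirdsRemainder
import HarnessLib

/-!
# Route `ExtremiserTransience`, crux `NearExtremalTransiencePerFlow` (stmt-NavierStokesRegularity-26567), LINE g10-1 «two_thirds»
# (ns-idea-10 g10), stub S2 `FirstOrderIdentity`: the REMAINDER ESTIMATE for a CURL-FREE remainder direction

Helper file for S2 (`--supports stmt-NavierStokesRegularity-26567`), sequel of `…TwoThirdsRemainder`.  In S2 the remainder direction
is `χ·G` with `G = ∇q` on an open set `T ⊇ tsupport χ` (the harmonic remainder of the Biot–Savart gauge), so `curl G = 0` on `T` and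
`curl(χ·G) = ∇χ × G` — written basis-free as the RANK-ONE CURL `curlCLM (Dχ ⊗ G)`.  Consequently `D(curl(χ·G))` involves only
`D²χ·G` and `Dχ·DG` and NO second derivative of `G`, and the remainder estimate of `…TwoThirdsRemainder` improves to

  `|a₁(χ·G)| ≤ (2A₁+κ⋆)·c·k₁g₀·∫_L‖ω‖ + (g₁∫_S|ω|² + k₁g₀∫_L|ω|²) + 3κ⋆·c·(k₂g₀ + k₁g₁)·∫_L√wd`

(`abs_a1_smul_le_of_curl_eq_zero`; `c = ‖curlCLM‖`, `|χ| ≤ 1_S`, `‖Dχ‖ ≤ k₁1_L`, `‖D²χ‖ ≤ k₂1_L`, `‖G‖ ≤ g₀`, `‖DG‖ ≤ g₁` on `T`).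
Also the rank-one curl calculus used again by the layer estimate: `norm_rankOneCurl_le`, `norm_iteratedFDeriv_rankOneCurl_le`,
`curl_smul_eq_rankOneCurl_of_curl_eq_zero`.

HONEST FRAMING: calculus/measure bookkeeping; nothing about Navier–Stokes regularity or blow-up is proved; S2, the crux ⟨26567⟩
and NS regularity are OPEN; no summit is proved by a line. [folklore]
-/

noncomputable section

open scoped Topology InnerProductSpace RealInnerProductSpace ENNReal ContDiff
open MeasureTheory Filter Set Metric
open Literature.Analysis.FluidPDE
open Summit.NavierStokesRegularity.NavierStokesRegularity.Theorems.DepletionLadder.KStar.HalfSpace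
open Summit.NavierStokesRegularity.NavierStokesRegularity.Theorems.DepletionLadder
open Summit.NavierStokesRegularity.NavierStokesRegularity.Theorems.NearExtremalTransiencePerFlow.LocalMaximiser

namespace Summit.NavierStokesRegularity.NavierStokesRegularity.Theorems.NearExtremalTransiencePerFlow.TwoThirds

-- the summit's namespace repeats the problem name by convention (D-0017)
set_option linter.dupNamespace false

variable {V G F : E3 → E3} {χ : E3 → ℝ}

/-! ## The rank-one curl `curlCLM (Dχ ⊗ F)` -/

/-- `‖curlCLM (Dχ(x) ⊗ F(x))‖ ≤ ‖curlCLM‖·‖Dχ(x)‖·‖F(x)‖`. [folklore] -/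
theorem norm_rankOneCurl_le (χ : E3 → ℝ) (F : E3 → E3) (x : E3) :
    ‖curlCLM ((fderiv ℝ χ x).smulRight (F x))‖ ≤ ‖curlCLM‖ * ‖fderiv ℝ χ x‖ * ‖F x‖ := by
  calc ‖curlCLM ((fderiv ℝ χ x).smulRight (F x))‖ ≤ ‖curlCLM‖ * ‖(fderiv ℝ χ x).smulRight (F x)‖ :=
        curlCLM.le_opNorm _
    _ = ‖curlCLM‖ * ‖fderiv ℝ χ x‖ * ‖F x‖ := by rw [ContinuousLinearMap.norm_smulRight_apply, mul_assoc]

/-- The rank-one curl of smooth data is smooth. [folklore] -/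
theorem contDiff_rankOneCurl (hχ : ContDiff ℝ (⊤ : ℕ∞) χ) (hF : ContDiff ℝ (⊤ : ℕ∞) F) :
    ContDiff ℝ (⊤ : ℕ∞) fun x => curlCLM ((fderiv ℝ χ x).smulRight (F x)) := by
  have hDχ : ContDiff ℝ (⊤ : ℕ∞) (fderiv ℝ χ) := (contDiff_infty_iff_fderiv.1 hχ).2
  have hB : ContDiff ℝ (⊤ : ℕ∞) fun x => ContinuousLinearMap.smulRightL ℝ E3 E3 (fderiv ℝ χ x) (F x) :=
    (ContinuousLinearMap.smulRightL ℝ E3 E3).isBoundedBilinearMap.contDiff.comp₂ hDχ hF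
  exact curlCLM.contDiff.comp hB

/-- **Leibniz for the rank-one curl**: `‖Dⁿ(curlCLM (Dχ ⊗ F))(x)‖ ≤ ‖curlCLM‖·Σᵢ C(n,i)‖Dⁱ⁺¹χ(x)‖‖Dⁿ⁻ⁱF(x)‖`. [folklore] -/
theorem norm_iteratedFDeriv_rankOneCurl_le (hχ : ContDiff ℝ (⊤ : ℕ∞) χ) (hF : ContDiff ℝ (⊤ : ℕ∞) F) (n : ℕ) (x : E3) :
    ‖iteratedFDeriv ℝ n (fun x => curlCLM ((fderiv ℝ χ x).smulRight (F x))) x‖ ≤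
      ‖curlCLM‖ * ∑ i ∈ Finset.range (n + 1),
        (n.choose i : ℝ) * ‖iteratedFDeriv ℝ (i + 1) χ x‖ * ‖iteratedFDeriv ℝ (n - i) F x‖ := by
  have hDχ : ContDiff ℝ (⊤ : ℕ∞) (fderiv ℝ χ) := (contDiff_infty_iff_fderiv.1 hχ).2
  have hB : ContDiff ℝ (⊤ : ℕ∞) fun x => ContinuousLinearMap.smulRightL ℝ E3 E3 (fderiv ℝ χ x) (F x) :=
    (ContinuousLinearMap.smulRightL ℝ E3 E3).isBoundedBilinearMap.contDiff.comp₂ hDχ hF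
  have e : (fun x => curlCLM ((fderiv ℝ χ x).smulRight (F x))) =
      curlCLM ∘ fun x => ContinuousLinearMap.smulRightL ℝ E3 E3 (fderiv ℝ χ x) (F x) := rfl
  rw [e]
  refine (ContinuousLinearMap.norm_iteratedFDeriv_comp_left curlCLM hB.contDiffAt (by exact_mod_cast le_top)).trans ?_
  refine mul_le_mul_of_nonneg_left ?_ (norm_nonneg _)
  refine (ContinuousLinearMap.norm_iteratedFDeriv_le_of_bilinear_of_le_one (ContinuousLinearMap.smulRightL ℝ E3 E3)
    hDχ hF x (by exact_mod_cast le_top) ContinuousLinearMap.norm_smulRightL_le).trans (le_of_eq ?_)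
  refine Finset.sum_congr rfl fun i _ => ?_
  rw [norm_iteratedFDeriv_fderiv]

/-- First derivative of the rank-one curl: `‖D(curlCLM (Dχ ⊗ F))(x)‖ ≤ c(‖D²χ‖‖F‖ + ‖Dχ‖‖DF‖)`. [folklore] -/
theorem norm_fderiv_rankOneCurl_le (hχ : ContDiff ℝ (⊤ : ℕ∞) χ) (hF : ContDiff ℝ (⊤ : ℕ∞) F) (x : E3) :
    ‖fderiv ℝ (fun x => curlCLM ((fderiv ℝ χ x).smulRight (F x))) x‖ ≤
      ‖curlCLM‖ * (‖iteratedFDeriv ℝ 2 χ x‖ * ‖F x‖ + ‖fderiv ℝ χ x‖ * ‖fderiv ℝ F x‖) := by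
  have h := norm_iteratedFDeriv_rankOneCurl_le hχ hF 1 x
  rw [norm_iteratedFDeriv_one, Finset.sum_range_succ, Finset.sum_range_succ, Finset.sum_range_zero] at h
  have e1 : ‖iteratedFDeriv ℝ (0 + 1) χ x‖ = ‖fderiv ℝ χ x‖ := norm_iteratedFDeriv_one χ
  have e2 : ‖iteratedFDeriv ℝ (1 - 0) F x‖ = ‖fderiv ℝ F x‖ := norm_iteratedFDeriv_one F
  have e3 : ‖iteratedFDeriv ℝ (1 + 1) χ x‖ = ‖iteratedFDeriv ℝ 2 χ x‖ := rfl
  have e4 : ‖iteratedFDeriv ℝ (1 - 1) F x‖ = ‖F x‖ := norm_iteratedFDeriv_zero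
  rw [e1, e2, e3, e4] at h
  simp only [zero_add, Nat.choose_zero_right, Nat.choose_self, Nat.cast_one, one_mul] at h
  linarith

/-- Second derivative of the rank-one curl: `‖D²(curlCLM (Dχ ⊗ F))(x)‖ ≤ c(‖D³χ‖‖F‖ + 2‖D²χ‖‖DF‖ + ‖Dχ‖‖D²F‖)`. [folklore] -/
theorem norm_iteratedFDeriv_two_rankOneCurl_le (hχ : ContDiff ℝ (⊤ : ℕ∞) χ) (hF : ContDiff ℝ (⊤ : ℕ∞) F) (x : E3) :
    ‖iteratedFDeriv ℝ 2 (fun x => curlCLM ((fderiv ℝ χ x).smulRight (F x))) x‖ ≤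
      ‖curlCLM‖ * (‖iteratedFDeriv ℝ 3 χ x‖ * ‖F x‖ + 2 * ‖iteratedFDeriv ℝ 2 χ x‖ * ‖fderiv ℝ F x‖ +
        ‖fderiv ℝ χ x‖ * ‖iteratedFDeriv ℝ 2 F x‖) := by
  have h := norm_iteratedFDeriv_rankOneCurl_le hχ hF 2 x
  rw [Finset.sum_range_succ, Finset.sum_range_succ, Finset.sum_range_succ, Finset.sum_range_zero] at h
  have e1 : ‖iteratedFDeriv ℝ (0 + 1) χ x‖ = ‖fderiv ℝ χ x‖ := norm_iteratedFDeriv_one χ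
  have e2 : ‖iteratedFDeriv ℝ (2 - 0) F x‖ = ‖iteratedFDeriv ℝ 2 F x‖ := rfl
  have e3 : ‖iteratedFDeriv ℝ (1 + 1) χ x‖ = ‖iteratedFDeriv ℝ 2 χ x‖ := rfl
  have e4 : ‖iteratedFDeriv ℝ (2 - 1) F x‖ = ‖fderiv ℝ F x‖ := norm_iteratedFDeriv_one F
  have e5 : ‖iteratedFDeriv ℝ (2 + 1) χ x‖ = ‖iteratedFDeriv ℝ 3 χ x‖ := rfl
  have e6 : ‖iteratedFDeriv ℝ (2 - 2) F x‖ = ‖F x‖ := norm_iteratedFDeriv_zero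
  rw [e1, e2, e3, e4, e5, e6] at h
  simp only [zero_add, Nat.choose_zero_right, Nat.choose_self, Nat.choose_one_right, Nat.cast_one, Nat.cast_ofNat,
    one_mul] at h
  linarith

/-- **The curl of `χ·G` where `G` is curl free**: `curl(χG)(x) = curlCLM (Dχ(x) ⊗ G(x))`. [folklore] -/
theorem curl_smul_eq_rankOneCurl_of_curl_eq_zero {x : E3} (hχ : DifferentiableAt ℝ χ x) (hG : DifferentiableAt ℝ G x)
    (h0 : curl G x = 0) : curl (fun y => χ y • G y) x = curlCLM ((fderiv ℝ χ x).smulRight (G x)) := by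
  rw [curl_smul hχ hG, h0, smul_zero, zero_add]

/-- On an open set where `G` is curl free, `curl(χG)` coincides near each point with the rank-one curl, so their derivatives agree.
[folklore] -/
theorem fderiv_curl_smul_eq_of_curl_eq_zero (hχ : ContDiff ℝ (⊤ : ℕ∞) χ) (hG : ContDiff ℝ (⊤ : ℕ∞) G) {T : Set E3}
    (hT : IsOpen T) (hcurl : ∀ y ∈ T, curl G y = 0) {x : E3} (hx : x ∈ T) :
    fderiv ℝ (curl fun y => χ y • G y) x = fderiv ℝ (fun y => curlCLM ((fderiv ℝ χ y).smulRight (G y))) x := by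
  have hχd : Differentiable ℝ χ := hχ.differentiable (by simp)
  have hGd : Differentiable ℝ G := hG.differentiable (by simp)
  have hev : (curl fun y => χ y • G y) =ᶠ[𝓝 x] fun y => curlCLM ((fderiv ℝ χ y).smulRight (G y)) := by
    filter_upwards [hT.mem_nhds hx] with y hy
    exact curl_smul_eq_rankOneCurl_of_curl_eq_zero (hχd y) (hGd y) (hcurl y hy)
  exact hev.fderiv_eq

/-! ## Pointwise bound for the `a₁`-density -/

/-- **Pointwise bound for the `a₁`-density** in terms of `‖Dr‖ ≤ m`, `‖curl r‖ ≤ b`, `‖D(curl r)‖ ≤ d` at `x` and `‖DV(x)‖ ≤ A₁`: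
`|c₁ − (κ⋆/2)(2z₁ + 2w₁)| ≤ (2A₁+κ⋆)·b·‖ω‖ + m·‖ω‖² + 3κ⋆·d·√wd`. [folklore] -/
theorem abs_a1Integrand_le_of_curl_bounds {r : E3 → E3} {x : E3} {A₁ m b d : ℝ} (hA : ‖fderiv ℝ V x‖ ≤ A₁)
    (hm : ‖fderiv ℝ r x‖ ≤ m) (hb : ‖curl r x‖ ≤ b) (hd : ‖fderiv ℝ (curl r) x‖ ≤ d) :
    |c1 V r x - (kStar / 2) * ((1 : ℝ)⁻¹ * (2 * z1 V r x) + 1 * (2 * w1 V r x))| ≤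
      (2 * A₁ + kStar) * b * ‖curl V x‖ + m * ‖curl V x‖ ^ 2 + 3 * kStar * d * Real.sqrt (wd V x) := by
  have hK : 0 < kStar := kStar_pos
  have hA0 : 0 ≤ A₁ := (norm_nonneg _).trans hA
  have hb0 : 0 ≤ b := (norm_nonneg _).trans hb
  have hd0 : 0 ≤ d := (norm_nonneg _).trans hd
  set w₀ := curl V x with hw₀
  have hDω : ‖fderiv ℝ (curl V) x‖ ≤ Real.sqrt (wd V x) := norm_fderiv_curl_le_sqrt_wd V x
  -- `c₁`
  have h1 : |c1 V r x| ≤ 2 * A₁ * b * ‖w₀‖ + m * ‖w₀‖ ^ 2 := by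
    unfold c1
    have t1 : |⟪curl r x, fderiv ℝ V x w₀⟫| ≤ b * (A₁ * ‖w₀‖) := by
      calc |⟪curl r x, fderiv ℝ V x w₀⟫| ≤ ‖curl r x‖ * ‖fderiv ℝ V x w₀‖ := abs_real_inner_le_norm _ _
        _ ≤ b * (A₁ * ‖w₀‖) := mul_le_mul hb ((ContinuousLinearMap.le_opNorm _ _).trans
            (mul_le_mul_of_nonneg_right hA (norm_nonneg _))) (norm_nonneg _) hb0
    have t2 : |⟪w₀, fderiv ℝ r x w₀⟫| ≤ m * ‖w₀‖ ^ 2 := by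
      calc |⟪w₀, fderiv ℝ r x w₀⟫| ≤ ‖w₀‖ * ‖fderiv ℝ r x w₀‖ := abs_real_inner_le_norm _ _
        _ ≤ ‖w₀‖ * (m * ‖w₀‖) := mul_le_mul_of_nonneg_left ((ContinuousLinearMap.le_opNorm _ _).trans
            (mul_le_mul_of_nonneg_right hm (norm_nonneg _))) (norm_nonneg _)
        _ = m * ‖w₀‖ ^ 2 := by ring
    have t3 : |⟪w₀, fderiv ℝ V x (curl r x)⟫| ≤ ‖w₀‖ * (A₁ * b) := by
      calc |⟪w₀, fderiv ℝ V x (curl r x)⟫| ≤ ‖w₀‖ * ‖fderiv ℝ V x (curl r x)‖ := abs_real_inner_le_norm _ _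
        _ ≤ ‖w₀‖ * (A₁ * b) := mul_le_mul_of_nonneg_left ((ContinuousLinearMap.le_opNorm _ _).trans
            (mul_le_mul hA hb (norm_nonneg _) hA0)) (norm_nonneg _)
    calc |⟪curl r x, fderiv ℝ V x w₀⟫ + ⟪w₀, fderiv ℝ r x w₀⟫ + ⟪w₀, fderiv ℝ V x (curl r x)⟫|
        ≤ |⟪curl r x, fderiv ℝ V x w₀⟫| + |⟪w₀, fderiv ℝ r x w₀⟫| + |⟪w₀, fderiv ℝ V x (curl r x)⟫| := abs_add_three _ _ _
      _ ≤ b * (A₁ * ‖w₀‖) + m * ‖w₀‖ ^ 2 + ‖w₀‖ * (A₁ * b) := by gcongr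
      _ = 2 * A₁ * b * ‖w₀‖ + m * ‖w₀‖ ^ 2 := by ring
  -- `z₁`
  have h2 : |z1 V r x| ≤ b * ‖w₀‖ := by
    unfold z1
    calc |⟪w₀, curl r x⟫| ≤ ‖w₀‖ * ‖curl r x‖ := abs_real_inner_le_norm _ _
      _ ≤ ‖w₀‖ * b := mul_le_mul_of_nonneg_left hb (norm_nonneg _)
      _ = b * ‖w₀‖ := by ring
  -- `w₁`
  have h3 : |w1 V r x| ≤ 3 * d * Real.sqrt (wd V x) := by
    unfold w1
    have hterm : ∀ i : Fin 3, |⟪fderiv ℝ (curl V) x (EuclideanSpace.basisFun (Fin 3) ℝ i),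
        fderiv ℝ (curl r) x (EuclideanSpace.basisFun (Fin 3) ℝ i)⟫| ≤ Real.sqrt (wd V x) * d := by
      intro i
      have he : ‖EuclideanSpace.basisFun (Fin 3) ℝ i‖ = 1 := by simp [EuclideanSpace.basisFun_apply]
      calc |⟪fderiv ℝ (curl V) x (EuclideanSpace.basisFun (Fin 3) ℝ i),
            fderiv ℝ (curl r) x (EuclideanSpace.basisFun (Fin 3) ℝ i)⟫|
          ≤ ‖fderiv ℝ (curl V) x (EuclideanSpace.basisFun (Fin 3) ℝ i)‖ *
              ‖fderiv ℝ (curl r) x (EuclideanSpace.basisFun (Fin 3) ℝ i)‖ := abs_real_inner_le_norm _ _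
        _ ≤ (‖fderiv ℝ (curl V) x‖ * 1) * (‖fderiv ℝ (curl r) x‖ * 1) := by
            rw [← he]
            exact mul_le_mul (ContinuousLinearMap.le_opNorm _ _) (ContinuousLinearMap.le_opNorm _ _)
              (norm_nonneg _) (by positivity)
        _ ≤ Real.sqrt (wd V x) * d := by
            rw [mul_one, mul_one]
            exact mul_le_mul hDω hd (norm_nonneg _) (Real.sqrt_nonneg _)
    calc |∑ i, ⟪fderiv ℝ (curl V) x (EuclideanSpace.basisFun (Fin 3) ℝ i),
          fderiv ℝ (curl r) x (EuclideanSpace.basisFun (Fin 3) ℝ i)⟫|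
        ≤ ∑ i, |⟪fderiv ℝ (curl V) x (EuclideanSpace.basisFun (Fin 3) ℝ i),
          fderiv ℝ (curl r) x (EuclideanSpace.basisFun (Fin 3) ℝ i)⟫| := Finset.abs_sum_le_sum_abs _ _
      _ ≤ ∑ _i : Fin 3, Real.sqrt (wd V x) * d := Finset.sum_le_sum fun i _ => hterm i
      _ = 3 * d * Real.sqrt (wd V x) := by
          rw [Finset.sum_const, Finset.card_univ, Fintype.card_fin, nsmul_eq_mul]
          push_cast
          ring
  -- combine
  have e : c1 V r x - (kStar / 2) * ((1 : ℝ)⁻¹ * (2 * z1 V r x) + 1 * (2 * w1 V r x)) =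
      c1 V r x - kStar * z1 V r x - kStar * w1 V r x := by ring
  rw [e]
  calc |c1 V r x - kStar * z1 V r x - kStar * w1 V r x|
      ≤ |c1 V r x| + |kStar * z1 V r x| + |kStar * w1 V r x| := by
        have := abs_sub (c1 V r x - kStar * z1 V r x) (kStar * w1 V r x)
        have := abs_sub (c1 V r x) (kStar * z1 V r x)
        linarith
    _ ≤ (2 * A₁ * b * ‖w₀‖ + m * ‖w₀‖ ^ 2) + kStar * (b * ‖w₀‖) + kStar * (3 * d * Real.sqrt (wd V x)) := by
        rw [abs_mul, abs_mul, abs_of_pos hK]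
        gcongr
    _ = (2 * A₁ + kStar) * b * ‖w₀‖ + m * ‖w₀‖ ^ 2 + 3 * kStar * d * Real.sqrt (wd V x) := by ring

/-! ## The remainder estimate for a curl-free remainder -/

/-- **THE REMAINDER ESTIMATE FOR A CURL-FREE REMAINDER DIRECTION** (see the module docstring). [folklore] -/
theorem abs_a1_smul_le_of_curl_eq_zero (hV : ContDiff ℝ (⊤ : ℕ∞) V) (hG : ContDiff ℝ (⊤ : ℕ∞) G)
    (hχ : ContDiff ℝ (⊤ : ℕ∞) χ) {T S L : Set E3} (hT : IsOpen T) (hχT : tsupport χ ⊆ T)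
    (hcurl : ∀ y ∈ T, curl G y = 0) (hSm : MeasurableSet S) (hLm : MeasurableSet L)
    (hSb : Bornology.IsBounded S) (hLb : Bornology.IsBounded L)
    {A₁ g₀ g₁ k₁ k₂ : ℝ} (hg₀0 : 0 ≤ g₀) (hg₁0 : 0 ≤ g₁) (hA : ∀ x, ‖fderiv ℝ V x‖ ≤ A₁)
    (hg₀ : ∀ x ∈ T, ‖G x‖ ≤ g₀) (hg₁ : ∀ x ∈ T, ‖fderiv ℝ G x‖ ≤ g₁)
    (hχS : ∀ x, |χ x| ≤ S.indicator (fun _ => (1 : ℝ)) x)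
    (hk₁ : ∀ x, ‖fderiv ℝ χ x‖ ≤ k₁ * L.indicator (fun _ => (1 : ℝ)) x)
    (hk₂ : ∀ x, ‖iteratedFDeriv ℝ 2 χ x‖ ≤ k₂ * L.indicator (fun _ => (1 : ℝ)) x) :
    |a1 kStar 1 V (fun y => χ y • G y)| ≤
      (2 * A₁ + kStar) * ‖curlCLM‖ * (k₁ * g₀) * (∫ x in L, ‖curl V x‖) +
      (g₁ * (∫ x in S, zd V x) + k₁ * g₀ * (∫ x in L, zd V x)) +
      3 * kStar * ‖curlCLM‖ * (k₂ * g₀ + k₁ * g₁) * (∫ x in L, Real.sqrt (wd V x)) := by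
  have hK : 0 < kStar := kStar_pos
  have hc0 : 0 ≤ ‖curlCLM‖ := norm_nonneg curlCLM
  have hA0 : 0 ≤ A₁ := (norm_nonneg _).trans (hA 0)
  have hχd : Differentiable ℝ χ := hχ.differentiable (by simp)
  have hGd : Differentiable ℝ G := hG.differentiable (by simp)
  -- continuity of the three weights
  have cω : Continuous fun x => ‖curl V x‖ := (continuous_curl (hV.of_le (by norm_cast))).norm
  have czd : Continuous (zd V) := continuous_zd' hV
  have cwd : Continuous fun x => Real.sqrt (wd V x) := (continuous_wd' hV).sqrt
  -- the four weighted integrals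
  obtain ⟨i1, e1⟩ := integral_indicator_mul_eq cω hLm hLb ((2 * A₁ + kStar) * ‖curlCLM‖ * (k₁ * g₀))
  obtain ⟨i2, e2⟩ := integral_indicator_mul_eq czd hSm hSb g₁
  obtain ⟨i3, e3⟩ := integral_indicator_mul_eq czd hLm hLb (k₁ * g₀)
  obtain ⟨i4, e4⟩ := integral_indicator_mul_eq cwd hLm hLb (3 * kStar * ‖curlCLM‖ * (k₂ * g₀ + k₁ * g₁))
  -- indicator shorthands
  set iS : E3 → ℝ := S.indicator (fun _ => (1 : ℝ)) with hiS
  set iL : E3 → ℝ := L.indicator (fun _ => (1 : ℝ)) with hiL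
  have hiS01 : ∀ x, 0 ≤ iS x ∧ iS x ≤ 1 := fun x => by
    by_cases hx : x ∈ S <;> simp [hiS, hx]
  have hiL0 : ∀ x, 0 ≤ iL x := fun x => by
    by_cases hx : x ∈ L <;> simp [hiL, hx]
  -- the majorant
  set M : E3 → ℝ := fun x =>
    (2 * A₁ + kStar) * ‖curlCLM‖ * (k₁ * g₀) * iL x * ‖curl V x‖ +
    (g₁ * iS x * zd V x + k₁ * g₀ * iL x * zd V x) +
    3 * kStar * ‖curlCLM‖ * (k₂ * g₀ + k₁ * g₁) * iL x * Real.sqrt (wd V x) with hM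
  -- pointwise bound
  have hpt : ∀ x, ‖c1 V (fun y => χ y • G y) x - (kStar / 2) * ((1 : ℝ)⁻¹ * (2 * z1 V (fun y => χ y • G y) x) +
      1 * (2 * w1 V (fun y => χ y • G y) x))‖ ≤ M x := by
    intro x
    rw [Real.norm_eq_abs]
    have hω0 : 0 ≤ ‖curl V x‖ := norm_nonneg _
    have hzd0 : 0 ≤ zd V x := by unfold zd; positivity
    have hwd0 : 0 ≤ Real.sqrt (wd V x) := Real.sqrt_nonneg _
    have hk₁x : 0 ≤ k₁ * iL x := (norm_nonneg _).trans (hk₁ x)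
    have hk₂x : 0 ≤ k₂ * iL x := (norm_nonneg _).trans (hk₂ x)
    by_cases hxT : x ∈ T
    · -- bounds for `Dr`, `curl r`, `D(curl r)` at `x`
      have hm : ‖fderiv ℝ (fun y => χ y • G y) x‖ ≤ g₁ * iS x + k₁ * g₀ * iL x := by
        calc ‖fderiv ℝ (fun y => χ y • G y) x‖ ≤ |χ x| * ‖fderiv ℝ G x‖ + ‖fderiv ℝ χ x‖ * ‖G x‖ :=
              norm_fderiv_smul_le hχ hG x
          _ ≤ iS x * g₁ + (k₁ * iL x) * g₀ :=
              add_le_add (mul_le_mul (hχS x) (hg₁ x hxT) (norm_nonneg _) (hiS01 x).1)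
                (mul_le_mul (hk₁ x) (hg₀ x hxT) (norm_nonneg _) hk₁x)
          _ = g₁ * iS x + k₁ * g₀ * iL x := by ring
      have hb : ‖curl (fun y => χ y • G y) x‖ ≤ ‖curlCLM‖ * (k₁ * g₀) * iL x := by
        rw [curl_smul_eq_rankOneCurl_of_curl_eq_zero (hχd x) (hGd x) (hcurl x hxT)]
        calc ‖curlCLM ((fderiv ℝ χ x).smulRight (G x))‖ ≤ ‖curlCLM‖ * ‖fderiv ℝ χ x‖ * ‖G x‖ :=
              norm_rankOneCurl_le χ G x
          _ ≤ ‖curlCLM‖ * (k₁ * iL x) * g₀ := by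
              rw [mul_assoc, mul_assoc]
              exact mul_le_mul_of_nonneg_left (mul_le_mul (hk₁ x) (hg₀ x hxT) (norm_nonneg _) hk₁x) hc0
          _ = ‖curlCLM‖ * (k₁ * g₀) * iL x := by ring
      have hd : ‖fderiv ℝ (curl fun y => χ y • G y) x‖ ≤ ‖curlCLM‖ * (k₂ * g₀ + k₁ * g₁) * iL x := by
        rw [fderiv_curl_smul_eq_of_curl_eq_zero hχ hG hT hcurl hxT]
        calc ‖fderiv ℝ (fun y => curlCLM ((fderiv ℝ χ y).smulRight (G y))) x‖
            ≤ ‖curlCLM‖ * (‖iteratedFDeriv ℝ 2 χ x‖ * ‖G x‖ + ‖fderiv ℝ χ x‖ * ‖fderiv ℝ G x‖) :=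
              norm_fderiv_rankOneCurl_le hχ hG x
          _ ≤ ‖curlCLM‖ * ((k₂ * iL x) * g₀ + (k₁ * iL x) * g₁) := by
              refine mul_le_mul_of_nonneg_left (add_le_add ?_ ?_) hc0
              · exact mul_le_mul (hk₂ x) (hg₀ x hxT) (norm_nonneg _) hk₂x
              · exact mul_le_mul (hk₁ x) (hg₁ x hxT) (norm_nonneg _) hk₁x
          _ = ‖curlCLM‖ * (k₂ * g₀ + k₁ * g₁) * iL x := by ring
      have h := abs_a1Integrand_le_of_curl_bounds (V := V) (hA x) hm hb hd
      refine h.trans (le_of_eq ?_)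
      have e1 : ‖curl V x‖ ^ 2 = zd V x := rfl
      rw [hM, e1]
      ring
    · have hx : x ∉ tsupport χ := fun h => hxT (hχT h)
      rw [a1Integrand_eq_zero_of_notMem_tsupport hx, abs_zero, hM]
      have hS0 : 0 ≤ iS x := (hiS01 x).1
      have c1' : 0 ≤ (2 * A₁ + kStar) * ‖curlCLM‖ := by positivity
      have u1 : 0 ≤ (2 * A₁ + kStar) * ‖curlCLM‖ * (k₁ * g₀) * iL x * ‖curl V x‖ := by
        have e : (2 * A₁ + kStar) * ‖curlCLM‖ * (k₁ * g₀) * iL x * ‖curl V x‖ =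
            (2 * A₁ + kStar) * ‖curlCLM‖ * g₀ * (k₁ * iL x) * ‖curl V x‖ := by ring
        rw [e]; positivity
      have u2 : 0 ≤ g₁ * iS x * zd V x := by positivity
      have u3 : 0 ≤ k₁ * g₀ * iL x * zd V x := by
        have e : k₁ * g₀ * iL x * zd V x = g₀ * (k₁ * iL x) * zd V x := by ring
        rw [e]; positivity
      have u4 : 0 ≤ 3 * kStar * ‖curlCLM‖ * (k₂ * g₀ + k₁ * g₁) * iL x * Real.sqrt (wd V x) := by
        have e : 3 * kStar * ‖curlCLM‖ * (k₂ * g₀ + k₁ * g₁) * iL x * Real.sqrt (wd V x) =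
            3 * kStar * ‖curlCLM‖ * (g₀ * (k₂ * iL x) + g₁ * (k₁ * iL x)) * Real.sqrt (wd V x) := by ring
        rw [e]; positivity
      show 0 ≤ _
      linarith
  -- integrate the majorant
  have iB : Integrable (fun x => g₁ * iS x * zd V x + k₁ * g₀ * iL x * zd V x) := i2.add i3
  have iAB : Integrable (fun x => (2 * A₁ + kStar) * ‖curlCLM‖ * (k₁ * g₀) * iL x * ‖curl V x‖ +
      (g₁ * iS x * zd V x + k₁ * g₀ * iL x * zd V x)) := i1.add iB
  have hMint : Integrable M := by
    simp only [hM]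
    exact iAB.add i4
  have hmain := norm_integral_le_of_norm_le hMint (Eventually.of_forall hpt)
  unfold a1
  rw [Real.norm_eq_abs] at hmain
  refine hmain.trans (le_of_eq ?_)
  simp only [hM]
  rw [integral_add iAB i4, integral_add i1 iB, integral_add i2 i3, e1, e2, e3, e4]

end Summit.NavierStokesRegularity.NavierStokesRegularity.Theorems.NearExtremalTransiencePerFlow.TwoThirds

end
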